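import Summits.AtomisticToContinuum.BoseEinsteinCondensation.Theorems.BECCutLineWeakDisorderWitnessTransferFiniteT
import Literature.MathematicalPhysics.QuantumManyBody.BoseGasDirichletWall
import HarnessLib

/-!
# Route BECCutLineWeakDisorder — `WitnessTransfer`, line `Sketch`: the glue (G)

Support file (does not close the item) for the crux stmt-AtomisticToContinuum-14978
(`Summit.AtomisticToContinuum.BoseEinsteinCondensation.Theses.BECCutLineWeakDisorder.WitnessTransfer`):
the registered stub `stub_landscape_of_parts` of the skeleton `Cruxes/WitnessTransfer/Lines/Sketch.lean`
— parts (B), (C), (E1a), (E1b), (F), (E2) ⇒ (two-replica clause at `v` ⇒ landscape clause at `v`),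
with `ρ₀ ↦ min ρ₀ ρ₀'` (finite energy eventually, `glue_eventually_groundStateEnergy_ne_top`) and
`C ↦ C + 1`, by `glue_landscape_at` at each eventual `n` and each `δ > 0`.
-/

noncomputable section

open MeasureTheory Filter Set Metric
open scoped ENNReal NNReal Topology

namespace Summit.AtomisticToContinuum.BoseEinsteinCondensation.Theorems.CutLineWitness

open Literature.MathematicalPhysics.QuantumManyBody.BoseGas
/-! ### (G) The glue -/

/-- **(G) The finite-`T` landscape witness and the bookkeeping.** If (B), (C), (E1a), (E1b),
(F), (E2) hold, then for every admissible `v` the two-replica clause implies the landscape clause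
(with `ρ₀ ↦ min ρ₀ ρ'₀`, `C ↦ C + 1`): at fixed `n` (eventual) and `δ > 0` take `T` with
`E_T ≤ E₀ + δ/4`, truncate `Ψ_T` at a level `η` (a form contraction; support off the walls by
the box-exit small-ball bound and off the hard set by (E2), where `V` is integrable by compactness),
mollify (E1b), and control the ratio by (F) and dominated convergence for the truncation.
[folklore] -/
theorem stub_landscape_of_parts
    (HB : ∀ {N : ℕ} {v : ℝ → ℝ≥0∞} (_ : Measurable v) (L : ℝ) {T : ℝ} (_ : 0 < T)
      (_ : fkNormSq (N := N) v L T (fun _ => 1) ≠ 0) {t : ℝ} (_ : 0 < t),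
      Real.exp (-(Real.log ((fkNormSq (N := N) v L 0 (fun _ => 1)).toReal /
          (fkNormSq (N := N) v L T (fun _ => 1)).toReal) / (2 * T) * t)) ≤
        ∫ X, fkWitness (N := N) v L T (fun _ => (1 : ℝ≥0∞)) X *
          fkReal v L t (fkWitness (N := N) v L T (fun _ => (1 : ℝ≥0∞))) X)
    (HC : ∀ {N : ℕ} {v : ℝ → ℝ≥0∞} (_ : Measurable v) {L : ℝ} (_ : 0 < L) (_ : 1 ≤ N)
      (_ : groundStateEnergy v N L ≠ ⊤),
      ∃ c : ℝ, 0 < c ∧ ∀ T : ℝ, 0 ≤ T →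
        ENNReal.ofReal (c * Real.exp (-(2 * (groundStateEnergy v N L).toReal * T))) ≤
          fkNormSq (N := N) v L T (fun _ => 1))
    (HE1a : ∀ {N : ℕ} {v : ℝ → ℝ≥0∞} (_ : Measurable v) {L : ℝ} (_ : 0 < L)
      {Ψ : Config N → ℝ} (_ : Measurable Ψ) {M : ℝ} (_ : ∀ X, |Ψ X| ≤ M) (_ : ∀ X, 0 ≤ Ψ X)
      (_ : ∀ X, X ∉ boxN N L → Ψ X = 0) (_ : ∫ X, Ψ X ^ 2 = 1) {E : ℝ}
      (_ : ∀ t : ℝ, 0 < t → Real.exp (-(E * t)) ≤ ∫ X, Ψ X * fkReal v L t Ψ X),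
      (∫⁻ X, ENNReal.ofReal (Ψ X ^ 2) * interaction v X) ≤ ENNReal.ofReal E ∧
      ∀ ε : ℝ, 0 < ε → ∀ᶠ t : ℝ≥0 in 𝓝[>] 0, (ENNReal.ofReal (2 * t))⁻¹ * sqIncr t Ψ ≤
        ENNReal.ofReal (E - (∫⁻ X, ENNReal.ofReal (Ψ X ^ 2) * interaction v X).toReal + ε))
    (HE1b : ∀ {N : ℕ} {v : ℝ → ℝ≥0∞} (_ : Measurable v) {L : ℝ} (_ : 0 < L)
      {f : Config N → ℝ} (_ : Measurable f) {M : ℝ} (_ : ∀ X, |f X| ≤ M) (_ : ∀ X, 0 ≤ f X)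
      (_ : ∀ (σ : Equiv.Perm (Fin N)) (X : Config N), f (X ∘ σ) = f X)
      (_ : 0 < ∫ X, f X ^ 2)
      {S : Set (Config N)} (_ : MeasurableSet S) (_ : S ⊆ boxN N L) {r₀ : ℝ} (_ : 0 < r₀)
      (_ : ∀ X, f X ≠ 0 → Metric.closedBall X r₀ ⊆ S)
      (_ : ∫⁻ X in S, interaction v X ≠ ⊤)
      {K : ℝ} (_ : 0 ≤ K)
      (_ : ∀ ε : ℝ, 0 < ε → ∀ᶠ t : ℝ≥0 in 𝓝[>] 0,
        (ENNReal.ofReal (2 * t))⁻¹ * sqIncr t f ≤ ENNReal.ofReal (K + ε))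
      {ε : ℝ} (_ : 0 < ε),
      ∃ r₁ : ℝ, 0 < r₁ ∧ ∀ (r : ℝ) (hr : 0 < r), r < r₁ → ∃ (c : ℝ) (Φ : TrialState N L),
        0 < c ∧ c ^ 2 * ∫ X, f X ^ 2 ≤ 1 + ε ∧
        (Φ.ψ = fun X => (((c * mollify hr f X : ℝ)) : ℂ)) ∧
        energy v Φ ≤ ENNReal.ofReal (c ^ 2) *
          (ENNReal.ofReal K + (∫⁻ X, ENNReal.ofReal (f X ^ 2) * interaction v X) +
            ENNReal.ofReal ε))
    (HF : ∀ {n : ℕ} {L : ℝ} {f : Config (n + 1) → ℝ} (_ : Measurable f) {M : ℝ}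
      (_ : ∀ X, |f X| ≤ M) (_ : ∀ X, 0 ≤ f X) {r₀ : ℝ} (_ : 0 < r₀)
      (_ : ∀ X, f X ≠ 0 → Metric.closedBall X r₀ ⊆ boxN (n + 1) L)
      {ε : ℝ≥0∞} (_ : 0 < ε),
      ∃ᶠ r in 𝓝[>] (0 : ℝ), ∀ hr : 0 < r,
        ∫⁻ Y : Config n, ENNReal.ofReal (L ^ 3) *
            (∫⁻ x, (‖mollify hr f (Matrix.vecCons x Y)‖₊ : ℝ≥0∞) ^ 2) ^ 2 /
              (∫⁻ x, (‖mollify hr f (Matrix.vecCons x Y)‖₊ : ℝ≥0∞)) ^ 2 ≤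
          (∫⁻ Y : Config n, ENNReal.ofReal (L ^ 3) *
            (∫⁻ x, (‖f (Matrix.vecCons x Y)‖₊ : ℝ≥0∞) ^ 2) ^ 2 /
              (∫⁻ x, (‖f (Matrix.vecCons x Y)‖₊ : ℝ≥0∞)) ^ 2) + ε)
    (HE2 : ∀ {N : ℕ} {v : ℝ → ℝ≥0∞} (_ : IsRepulsiveFiniteRange v) (L : ℝ) {T : ℝ}
      (_ : 0 < T) {η : ℝ} (_ : 0 < η),
      ∃ κ : ℝ, 0 < κ ∧ ∀ X : Config N,
        (∃ i j : Fin N, i ≠ j ∧ ∃ z ∈ hardVec v, dist (X i - X j) z < κ) →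
          fkSemigroup v L T (fun _ => (1 : ℝ≥0∞)) X ≤ ENNReal.ofReal η)
    (v : ℝ → ℝ≥0∞) (hv : IsRepulsiveFiniteRange v)
    (hTR : ∃ ρ₀ : ℝ, 0 < ρ₀ ∧ ∀ ρ : ℝ, 0 < ρ → ρ < ρ₀ → ∃ C : ℝ, 0 < C ∧
      ∀ᶠ n : ℕ in Filter.atTop, ∀ T : ℝ, 1 ≤ T →
        ∫⁻ Y : Config n, ENNReal.ofReal (sideLength ρ (n + 1) ^ 3) *
          (∫⁻ x, (‖fkWitness (N := n + 1) v (sideLength ρ (n + 1)) T (fun _ => (1 : ℝ≥0∞))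
            (Matrix.vecCons x Y)‖₊ : ℝ≥0∞) ^ 2) ^ 2 /
          (∫⁻ x, (‖fkWitness (N := n + 1) v (sideLength ρ (n + 1)) T (fun _ => (1 : ℝ≥0∞))
            (Matrix.vecCons x Y)‖₊ : ℝ≥0∞)) ^ 2 ≤ ENNReal.ofReal C) :
    ∃ ρ₀ : ℝ, 0 < ρ₀ ∧ ∀ ρ : ℝ, 0 < ρ → ρ < ρ₀ → ∃ C : ℝ, 0 < C ∧
      ∀ᶠ n : ℕ in Filter.atTop, ∀ δ : ℝ≥0∞, 0 < δ →
        ∃ Ψ : TrialState (n + 1) (sideLength ρ (n + 1)),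
          energy v Ψ ≤ groundStateEnergy v (n + 1) (sideLength ρ (n + 1)) + δ ∧
          (∀ X, Ψ.ψ X = (‖Ψ.ψ X‖ : ℂ)) ∧
          ∫⁻ Y : Config n, ENNReal.ofReal (sideLength ρ (n + 1) ^ 3) *
            (∫⁻ x, (‖Ψ.ψ (Matrix.vecCons x Y)‖₊ : ℝ≥0∞) ^ 2) ^ 2 /
              (∫⁻ x, (‖Ψ.ψ (Matrix.vecCons x Y)‖₊ : ℝ≥0∞)) ^ 2 ≤ ENNReal.ofReal C := by
  obtain ⟨ρ₁, hρ₁, H1⟩ := hTR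
  obtain ⟨ρ₂, hρ₂, H2⟩ := glue_eventually_groundStateEnergy_ne_top v hv
  refine ⟨min ρ₁ ρ₂, lt_min hρ₁ hρ₂, fun ρ hρ hρlt => ?_⟩
  obtain ⟨C, hC, hevC⟩ := H1 ρ hρ (hρlt.trans_le (min_le_left _ _))
  refine ⟨C + 1, by linarith, ?_⟩
  filter_upwards [hevC, H2 ρ hρ (hρlt.trans_le (min_le_right _ _))] with n hrat hEfin
  intro δ hδ
  exact glue_landscape_at HB HC HE1a HE1b HF hv (fun L _ hT _ hη => HE2 hv L hT hη)
    (sideLength_pos_of_pos hρ (Nat.succ_pos n)) hEfin hC.le hrat hδ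

end Summit.AtomisticToContinuum.BoseEinsteinCondensation.Theorems.CutLineWitness

end
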